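import Literature.NumberTheory.PAdicHodge.CompletedAlgClosurePadicComplex
import Literature.NumberTheory.PAdicHodge.UnramifiedCompletionToPadicComplex
import Literature.NumberTheory.GaloisRepresentations.PadicComplexRootsOfUnityPoints
import Literature.NumberTheory.GaloisRepresentations.LubinTateComparisonPoints
import Mathlib.Analysis.SpecificLimits.Normed
import HarnessLib

/-!
# Transport of the `Ĝ_m`-trace condition along `θ : ℂ_F ≃+* ℂ_[p]` (`F = ℚ_p`)

Topic `NumberTheory/PAdicHodge`; namespace `Literature.NumberTheory.PAdicHodge`. Cell `bsd-print-cf2`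
(HOME `run/shared/lean/pub/bsd-print-cf2/`), seat `bsd-line-cf2-p1-w7` g7; sequel of
`CompletedAlgClosurePadicComplex.lean` (the field identification `θ = CompletedAlgClosure.equivPadicComplex p`).
The Lubin–Tate comparison (de Shalit I §3.2–3.3) produces, in the TREE's `ℂ_F = CompletedAlgClosure ℚ_[p]`, a
series `H ∈ 𝒪_{ℂ_F}⟦S⟧` whose `Ĝ_m`-trace vanishes at all `p`-power torsion:
`Σ_{w^p = 1} Σ_m H_m (ζw − 1)^m = 0` for every `ζ ∈ ℂ_F` with `ζ^{p^n} = 1` (at `q = 2`: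
`sum_nthRootsFinset_tsum_coeff_subst_compSeriesC_eq_zero`, `LubinTateComparisonReflectionTwo.lean`). The
measure-side support criterion (`PadicComplex.forall_invAmice₁_μ_eq_zero_of_nthRoots`, socket
`integral_restrictUnits_density_unitInv_pow_succ_eq_constantCoeff`) asks for the same identity for a series over
Mathlib's `ℂ_[p]` with bounded coefficients. This file moves the one to the other:

* `norm_natCast_prime_completedAlgClosure_lt_one` — `‖p‖ < 1` in `ℂ_F` (through `θ`);
* `sum_nthRootsFinset_eq_sum_comp_equivPadicComplex` — `θ` bijects `{w ∈ ℂ_F : w^n = 1}` onto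
  `{w ∈ ℂ_[p] : w^n = 1}`: `Σ_{w^n = 1 in ℂ_[p]} g(w) = Σ_{w^n = 1 in ℂ_F} g(θ w)`;
* `summable_norm_le_one_mul_pow` — `Σ_m c_m y^m` converges when `‖c_m‖ ≤ 1`, `‖y‖ < 1` (any complete normed
  field); `equivPadicComplex_tsum_coeff_mul_pow` — **`θ(Σ_m H_m y^m) = Σ_m θ(H_m) θ(y)^m`**;
  `norm_coeff_map_equivPadicComplex_le_one` — `‖θ(H_m)‖ ≤ 1` (the criterion's `hC` with `C = 1`);
* ★ **`PadicComplex.sum_nthRootsFinset_tsum_coeff_map_eq_zero`** — if the `Ĝ_m`-trace of `H ∈ 𝒪_{ℂ_F}⟦S⟧`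
  vanishes at all `p`-power roots of unity of `ℂ_F`, then that of `H.map θ ∈ ℂ_[p]⟦S⟧` vanishes at all
  `p`-power roots of unity of `ℂ_[p]` — VERBATIM the hypothesis `htrace` of the criterion; and the same with
  `H ∈ (CBall-valued)` coefficients read through the inclusion (`…_of_subtype`, the currency of
  `LubinTateComparisonReflectionTwo`);
* ★ **`CompletedAlgClosure.equivPadicComplex_toC`** — `θ ∘ ι = J` on `𝐃 = 𝒪̂_{ℚ_p^nr}`: the tree's embedding
  `ι = maxUnramifiedCompletion.toC ℚ_[p]` followed by `θ` IS the direct `p`-adic lift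
  `J = maxUnramifiedCompletion.toPadicComplex p` of `UnramifiedCompletionToPadicComplex.lean` (both are congruence-
  compatible extensions of `𝒪_{ℚ_p^nr} ⊆ ℚ̄_p ⊆ ℂ_p`; compared modulo every `pⁿ` in the `p`-adically separated
  `𝓞_{ℂ_p}`), so `(H.map ι).map θ = H.map J` for every `H ∈ 𝐃⟦S⟧` (`map_equivPadicComplex_map_toC`): the two
  readings of a `𝐃`-series in `ℂ_[p]` coincide.

Theorems only; no definition, no named fact, no `sorry`. HONEST FRAMING: bookkeeping between two models of
`ℂ_p`; BSD is not advanced by this file.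

## References
* [deShalit1987] E. de Shalit, *Iwasawa theory of elliptic curves with complex multiplication* (1987), I §3.3
  (7)–(7′) (the trace condition at the points `ς(1+S) − 1`).
* [FontaineOuyang2022] J.-M. Fontaine, Y. Ouyang, *Theory of p-adic Galois representations*, §3.1 (`ℂ_p`).
-/

noncomputable section

open ValuativeRel Field UniformSpace Filter Topology

namespace Literature.NumberTheory.PAdicHodge

open Literature.NumberTheory.GaloisRepresentations
open Literature.NumberTheory.GaloisRepresentations.IsNonarchimedeanLocalField LubinTate

variable (p : ℕ) [hp : Fact p.Prime]

/-! ### Roots of unity and `‖p‖` under `θ` -/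

section Roots

/-- `(θ z)^n = 1 ↔ z^n = 1`: `θ` is an injective ring homomorphism. [cite: FontaineOuyang2022, §3.1] -/
theorem equivPadicComplex_pow_eq_one_iff
    (z : haveI := Padic.isNonarchimedeanLocalField_holds p; CompletedAlgClosure ℚ_[p]) (n : ℕ) :
    haveI := Padic.isNonarchimedeanLocalField_holds p
    CompletedAlgClosure.equivPadicComplex p z ^ n = 1 ↔ z ^ n = 1 := by
  haveI := Padic.isNonarchimedeanLocalField_holds p
  rw [← map_pow, map_eq_one_iff _ (CompletedAlgClosure.equivPadicComplex p).injective]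

/-- `(θ⁻¹ y)^n = 1 ↔ y^n = 1`. [cite: FontaineOuyang2022, §3.1] -/
theorem equivPadicComplex_symm_pow_eq_one_iff (y : ℂ_[p]) (n : ℕ) :
    haveI := Padic.isNonarchimedeanLocalField_holds p
    (CompletedAlgClosure.equivPadicComplex p).symm y ^ n = 1 ↔ y ^ n = 1 := by
  haveI := Padic.isNonarchimedeanLocalField_holds p
  rw [← map_pow, map_eq_one_iff _ (CompletedAlgClosure.equivPadicComplex p).symm.injective]

/-- **`‖p‖ < 1` in the tree's `ℂ_F` (`F = ℚ_p`)**, read through `θ` from Mathlib's `‖(p : ℂ_[p])‖ = p⁻¹ < 1`.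
[cite: FontaineOuyang2022, §3.1] -/
theorem norm_natCast_prime_completedAlgClosure_lt_one :
    haveI := Padic.isNonarchimedeanLocalField_holds p
    ‖((p : ℕ) : CompletedAlgClosure ℚ_[p])‖ < 1 := by
  haveI := Padic.isNonarchimedeanLocalField_holds p
  rw [← CompletedAlgClosure.norm_equivPadicComplex_lt_one_iff, map_natCast]
  exact Literature.NumberTheory.EllipticCurves.norm_prime_padicComplex_lt_one (p := p)

/-- **`θ` bijects the `n`-th roots of unity**: a sum over `{w ∈ ℂ_[p] : w^n = 1}` is the corresponding sum over
`{w ∈ ℂ_F : w^n = 1}` composed with `θ`. [cite: FontaineOuyang2022, §3.1] -/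
theorem sum_nthRootsFinset_eq_sum_comp_equivPadicComplex {M : Type*} [AddCommMonoid M]
    (g : ℂ_[p] → M) {n : ℕ} (hn : 0 < n) :
    haveI := Padic.isNonarchimedeanLocalField_holds p
    ∑ w ∈ Polynomial.nthRootsFinset n (1 : ℂ_[p]), g w =
      ∑ w ∈ Polynomial.nthRootsFinset n (1 : CompletedAlgClosure ℚ_[p]),
        g (CompletedAlgClosure.equivPadicComplex p w) := by
  haveI := Padic.isNonarchimedeanLocalField_holds p
  symm
  refine Finset.sum_equiv (CompletedAlgClosure.equivPadicComplex p).toEquiv (fun w => ?_) (fun w _ => rfl)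
  rw [Polynomial.mem_nthRootsFinset hn, Polynomial.mem_nthRootsFinset hn]
  exact (equivPadicComplex_pow_eq_one_iff p w n).symm

end Roots

/-! ### `θ` through convergent power sums -/

section Sums

/-- In a complete normed field, `Σ_m c_m y^m` converges absolutely when `‖c_m‖ ≤ 1` and `‖y‖ < 1` (comparison
with the geometric series). [cite: deShalit1987, I §3.3 (7)] -/
theorem summable_norm_le_one_mul_pow {K : Type*} [NormedField K] [CompleteSpace K] {c : ℕ → K}
    (hc : ∀ m, ‖c m‖ ≤ 1) {y : K} (hy : ‖y‖ < 1) : Summable fun m : ℕ => c m * y ^ m := by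
  refine Summable.of_norm_bounded (summable_geometric_of_lt_one (norm_nonneg y) hy) fun m => ?_
  rw [norm_mul, norm_pow]
  exact mul_le_of_le_one_left (pow_nonneg (norm_nonneg y) m) (hc m)

variable {H : haveI := Padic.isNonarchimedeanLocalField_holds p; PowerSeries (CompletedAlgClosure ℚ_[p])}

/-- `‖θ(H_m)‖ ≤ 1` when `‖H_m‖ ≤ 1`: the coefficient bound `hC` (with `C = 1`) of the support criterion for
`H.map θ`. [cite: deShalit1987, I §3.3 (7)] -/
theorem norm_coeff_map_equivPadicComplex_le_one
    (hH : haveI := Padic.isNonarchimedeanLocalField_holds p; ∀ m, ‖PowerSeries.coeff m H‖ ≤ 1) (m : ℕ) :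
    haveI := Padic.isNonarchimedeanLocalField_holds p
    ‖PowerSeries.coeff m (H.map (CompletedAlgClosure.equivPadicComplex p).toRingHom)‖ ≤ 1 := by
  haveI := Padic.isNonarchimedeanLocalField_holds p
  rw [PowerSeries.coeff_map, RingEquiv.toRingHom_eq_coe, RingHom.coe_coe,
    CompletedAlgClosure.norm_equivPadicComplex_le_one_iff]
  exact hH m

/-- **`θ(Σ_m H_m y^m) = Σ_m θ(H_m) θ(y)^m`** for `‖H_m‖ ≤ 1`, `‖y‖ < 1` (`θ` is a continuous ring
homomorphism; the sum converges). [cite: deShalit1987, I §3.3 (7)] -/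
theorem equivPadicComplex_tsum_coeff_mul_pow
    (hH : haveI := Padic.isNonarchimedeanLocalField_holds p; ∀ m, ‖PowerSeries.coeff m H‖ ≤ 1)
    {y : haveI := Padic.isNonarchimedeanLocalField_holds p; CompletedAlgClosure ℚ_[p]} (hy : ‖y‖ < 1) :
    haveI := Padic.isNonarchimedeanLocalField_holds p
    CompletedAlgClosure.equivPadicComplex p (∑' m : ℕ, PowerSeries.coeff m H * y ^ m) =
      ∑' m : ℕ, PowerSeries.coeff m (H.map (CompletedAlgClosure.equivPadicComplex p).toRingHom) *
        (CompletedAlgClosure.equivPadicComplex p y) ^ m := by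
  haveI := Padic.isNonarchimedeanLocalField_holds p
  have hs := (summable_norm_le_one_mul_pow hH hy).hasSum.map (CompletedAlgClosure.equivPadicComplex p)
    (CompletedAlgClosure.continuous_equivPadicComplex p)
  rw [← hs.tsum_eq]
  refine tsum_congr fun m => ?_
  simp only [Function.comp_apply, map_mul, map_pow, PowerSeries.coeff_map, RingEquiv.toRingHom_eq_coe,
    RingHom.coe_coe]

end Sums

/-! ### ★ The transport of the trace condition -/

section Transport

/-- ★ **Transport of the `Ĝ_m`-trace condition from `ℂ_F` to `ℂ_[p]`**: if `H ∈ ℂ_F⟦S⟧` has `‖H_m‖ ≤ 1` and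
`Σ_{w^p = 1} Σ_m H_m (ζw − 1)^m = 0` for every `p`-power root of unity `ζ ∈ ℂ_F`, then `H.map θ ∈ ℂ_[p]⟦S⟧`
satisfies `Σ_{w^p = 1} Σ_m θ(H_m) (εw − 1)^m = 0` for every `p`-power root of unity `ε ∈ ℂ_[p]` — verbatim the
hypothesis `htrace` of `PadicComplex.forall_invAmice₁_μ_eq_zero_of_nthRoots` (with `hC` from
`norm_coeff_map_equivPadicComplex_le_one`). [cite: deShalit1987, I §3.3 (7)–(7′)] -/
theorem PadicComplex.sum_nthRootsFinset_tsum_coeff_map_eq_zero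
    (H : haveI := Padic.isNonarchimedeanLocalField_holds p; PowerSeries (CompletedAlgClosure ℚ_[p]))
    (hH : haveI := Padic.isNonarchimedeanLocalField_holds p; ∀ m, ‖PowerSeries.coeff m H‖ ≤ 1)
    (htrace : haveI := Padic.isNonarchimedeanLocalField_holds p;
      ∀ ζ : CompletedAlgClosure ℚ_[p], (∃ n : ℕ, ζ ^ p ^ n = 1) →
      ∑ w ∈ Polynomial.nthRootsFinset p (1 : CompletedAlgClosure ℚ_[p]),
        ∑' m : ℕ, PowerSeries.coeff m H * (ζ * w - 1) ^ m = 0)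
    (ε : ℂ_[p]) (hε : ∃ n : ℕ, ε ^ p ^ n = 1) :
    haveI := Padic.isNonarchimedeanLocalField_holds p
    ∑ w ∈ Polynomial.nthRootsFinset p (1 : ℂ_[p]),
      ∑' m : ℕ, PowerSeries.coeff m (H.map (CompletedAlgClosure.equivPadicComplex p).toRingHom) *
        (ε * w - 1) ^ m = 0 := by
  haveI := Padic.isNonarchimedeanLocalField_holds p
  set θ := CompletedAlgClosure.equivPadicComplex p with hθ
  obtain ⟨n, hn⟩ := hε
  -- `ε = θ ζ` with `ζ` a `p`-power root of unity of `ℂ_F`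
  set ζ := θ.symm ε with hζ
  have hζn : ζ ^ p ^ n = 1 := (equivPadicComplex_symm_pow_eq_one_iff p ε (p ^ n)).mpr hn
  have hεζ : ε = θ ζ := (RingEquiv.apply_symm_apply θ ε).symm
  have hpC := norm_natCast_prime_completedAlgClosure_lt_one p
  rw [sum_nthRootsFinset_eq_sum_comp_equivPadicComplex p _ hp.out.pos]
  have key := htrace ζ ⟨n, hζn⟩
  have hterm : ∀ w ∈ Polynomial.nthRootsFinset p (1 : CompletedAlgClosure ℚ_[p]),
      ∑' m : ℕ, PowerSeries.coeff m (H.map θ.toRingHom) * (ε * θ w - 1) ^ m =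
        θ (∑' m : ℕ, PowerSeries.coeff m H * (ζ * w - 1) ^ m) := by
    intro w hw
    rw [Polynomial.mem_nthRootsFinset hp.out.pos] at hw
    have hw' : w ^ p ^ 1 = 1 := by rw [pow_one]; exact hw
    have hy : ‖ζ * w - 1‖ < 1 := norm_mul_sub_one_lt_one_of_pow_prime_pow_eq_one hpC n 1 hζn hw'
    rw [equivPadicComplex_tsum_coeff_mul_pow p hH hy, map_sub, map_mul, map_one, ← hεζ]
  rw [Finset.sum_congr rfl hterm, ← map_sum, key, map_zero]

/-- The same with the coefficients of `H` given in `𝒪_{ℂ_F} = CBall`-currency and read in `ℂ_F` through the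
inclusion — the exact output shape of `sum_nthRootsFinset_tsum_coeff_subst_compSeriesC_eq_zero`
(`LubinTateComparisonReflectionTwo.lean`): for `H ∈ 𝒪_{ℂ_F}⟦S⟧`, the series
`H.map (θ ∘ incl) ∈ ℂ_[p]⟦S⟧` satisfies the criterion's `htrace`. [cite: deShalit1987, I §3.3 (7)–(7′)] -/
theorem PadicComplex.sum_nthRootsFinset_tsum_coeff_map_eq_zero_of_subtype
    (H : haveI := Padic.isNonarchimedeanLocalField_holds p; PowerSeries (CBall ℚ_[p]))
    (htrace : haveI := Padic.isNonarchimedeanLocalField_holds p;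
      ∀ ζ : CompletedAlgClosure ℚ_[p], (∃ n : ℕ, ζ ^ p ^ n = 1) →
      ∑ w ∈ Polynomial.nthRootsFinset p (1 : CompletedAlgClosure ℚ_[p]),
        ∑' m : ℕ, ((PowerSeries.coeff m H : CBall ℚ_[p]) : CompletedAlgClosure ℚ_[p]) * (ζ * w - 1) ^ m = 0)
    (ε : ℂ_[p]) (hε : ∃ n : ℕ, ε ^ p ^ n = 1) :
    haveI := Padic.isNonarchimedeanLocalField_holds p
    ∑ w ∈ Polynomial.nthRootsFinset p (1 : ℂ_[p]),
      ∑' m : ℕ, PowerSeries.coeff m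
          (H.map ((CompletedAlgClosure.equivPadicComplex p).toRingHom.comp (CBall ℚ_[p]).subtype)) *
        (ε * w - 1) ^ m = 0 := by
  haveI := Padic.isNonarchimedeanLocalField_holds p
  have h1 : H.map ((CompletedAlgClosure.equivPadicComplex p).toRingHom.comp (CBall ℚ_[p]).subtype) =
      (H.map (CBall ℚ_[p]).subtype).map (CompletedAlgClosure.equivPadicComplex p).toRingHom := by
    rw [PowerSeries.map_comp, RingHom.comp_apply]
  rw [h1]
  refine PadicComplex.sum_nthRootsFinset_tsum_coeff_map_eq_zero p _ (fun m => ?_) (fun ζ hζ => ?_) ε hε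
  · rw [PowerSeries.coeff_map, Subring.subtype_apply]
    exact (mem_unitBall_iff _).mp (PowerSeries.coeff m H).2
  · simpa only [PowerSeries.coeff_map, Subring.subtype_apply] using htrace ζ hζ

/-- `‖θ(↑H_m)‖ ≤ 1` for `H ∈ 𝒪_{ℂ_F}⟦S⟧`: the criterion's `hC` (with `C = 1`) for `H.map (θ ∘ incl)`.
[cite: deShalit1987, I §3.3 (7)] -/
theorem norm_coeff_map_equivPadicComplex_subtype_le_one
    (H : haveI := Padic.isNonarchimedeanLocalField_holds p; PowerSeries (CBall ℚ_[p])) (m : ℕ) :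
    haveI := Padic.isNonarchimedeanLocalField_holds p
    ‖PowerSeries.coeff m
        (H.map ((CompletedAlgClosure.equivPadicComplex p).toRingHom.comp (CBall ℚ_[p]).subtype))‖ ≤ 1 := by
  haveI := Padic.isNonarchimedeanLocalField_holds p
  rw [PowerSeries.coeff_map, RingHom.comp_apply, Subring.subtype_apply, RingEquiv.toRingHom_eq_coe,
    RingHom.coe_coe, CompletedAlgClosure.norm_equivPadicComplex_le_one_iff]
  exact (mem_unitBall_iff _).mp (PowerSeries.coeff m H).2

end Transport

/-! ### `θ ∘ ι = J`: the two coefficient maps `𝐃 = 𝒪̂_{ℚ_p^nr} → ℂ_p` agree -/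

section Coefficients

/-- **`θ ∘ ι = J` on `𝐃 = 𝒪̂_{ℚ_p^nr}`**: the tree's embedding `ι = maxUnramifiedCompletion.toC ℚ_[p] : 𝐃 → ℂ_F`
followed by `θ` is the direct `p`-adic lift `J = maxUnramifiedCompletion.toPadicComplex p : 𝐃 → ℂ_[p]`
(`UnramifiedCompletionToPadicComplex.lean`): both restrict to the inclusion on `𝒪_{ℚ_p^nr} ⊆ ℚ̄_p` and are
congruence-compatible, so they agree modulo every `pⁿ` in the `p`-adically separated `𝓞_{ℂ_p}`. Hence a series
`H ∈ 𝐃⟦S⟧` read in `ℂ_[p]` through `θ ∘ ι` (the Lubin–Tate files) or through `J` is the same series.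
[cite: FontaineOuyang2022, §3.1] -/
theorem CompletedAlgClosure.equivPadicComplex_toC
    (x : haveI := Padic.isNonarchimedeanLocalField_holds p; maxUnramifiedCompletion ℚ_[p]) :
    haveI := Padic.isNonarchimedeanLocalField_holds p
    CompletedAlgClosure.equivPadicComplex p (maxUnramifiedCompletion.toC ℚ_[p] x) =
      maxUnramifiedCompletion.toPadicComplex p x := by
  haveI := Padic.isNonarchimedeanLocalField_holds p
  haveI hJc := isAdicComplete_unitBall_padicComplex p
  set θ := CompletedAlgClosure.equivPadicComplex p with hθdef
  have hϖ := (exists_irreducible_integer (F := ℚ_[p])).choose_spec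
  set ϖ : 𝒪[ℚ_[p]] := (exists_irreducible_integer (F := ℚ_[p])).choose with hϖdef
  set pb : unitBall ℂ_[p] := ⟨(p : ℂ_[p]), natCast_mem_unitBall p⟩ with hpbdef
  set Jp : Ideal (unitBall ℂ_[p]) := Ideal.span {pb} with hJpdef
  set I : Ideal (integerC ℚ_[p]) := Ideal.span {unifC ϖ} with hIdef
  -- `θ` restricted to the integers
  let θi : integerC ℚ_[p] →+* unitBall ℂ_[p] :=
    (θ.toRingHom.comp (integerC ℚ_[p]).subtype).codRestrict (unitBall ℂ_[p]) fun y => by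
      rw [mem_unitBall_iff]
      change ‖θ (y : CompletedAlgClosure ℚ_[p])‖ ≤ 1
      rw [CompletedAlgClosure.norm_equivPadicComplex_le_one_iff]
      exact y.2
  have hθi : ∀ y : integerC ℚ_[p], ((θi y : unitBall ℂ_[p]) : ℂ_[p]) = θ (y : CompletedAlgClosure ℚ_[p]) :=
    fun y => rfl
  -- `θi` is the inclusion on `𝒪_{ℚ_p^nr}`
  have hθi_of : ∀ b : maxUnramifiedIntegers ℚ_[p],
      θi (ofMaxUnramifiedIntegers ℚ_[p] b) = ofMaxUnramifiedIntegersPadic p b := fun b => by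
    apply Subtype.ext
    rw [hθi, coe_ofMaxUnramifiedIntegers, coe_ofMaxUnramifiedIntegersPadic,
      CompletedAlgClosure.equivPadicComplex_algClosureToC]
  -- `θi (ϖ) ∈ (p)`: `ϖ = p · w` with `w` a unit of `𝒪[ℚ_[p]]`
  have hunifC_mul : ∀ a b : 𝒪[ℚ_[p]], (unifC (a * b) : integerC ℚ_[p]) = unifC a * unifC b := fun a b => by
    change ofMaxUnramifiedIntegers ℚ_[p] (algebraMap _ _ (a * b)) = _
    rw [map_mul, map_mul]; rfl
  have hθi_p : θi (unifC ((p : ℕ) : 𝒪[ℚ_[p]])) = pb := by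
    apply Subtype.ext
    rw [hθi, coe_unifC, CompletedAlgClosure.equivPadicComplex_algebraMap]
    change (((((p : ℕ) : 𝒪[ℚ_[p]]) : ℚ_[p]) : PadicAlgCl p) : ℂ_[p]) = (p : ℂ_[p])
    push_cast
    rfl
  obtain ⟨w, hw⟩ := IsDiscreteValuationRing.associated_of_irreducible 𝒪[ℚ_[p]]
    (Padic.irreducible_natCast_valuationInteger p) hϖ
  have hI : θi (unifC ϖ) ∈ Jp := by
    rw [← hw, hunifC_mul, map_mul, hθi_p]
    exact Ideal.mul_mem_right _ _ (Ideal.mem_span_singleton_self _)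
  have hle : ∀ n, I ^ n ≤ (Jp ^ n).comap θi := fun n => by
    rw [hIdef, Ideal.span_singleton_pow, Ideal.span_le, Set.singleton_subset_iff, SetLike.mem_coe,
      Ideal.mem_comap, map_pow]
    exact Ideal.pow_mem_pow hI n
  -- both sides live in `𝓞_{ℂ_p}`; compare modulo `pⁿ`
  change ((θi (toCInt hϖ x) : unitBall ℂ_[p]) : ℂ_[p]) =
    ((maxUnramifiedCompletion.toPadicComplexInt p x : unitBall ℂ_[p]) : ℂ_[p])
  congr 1
  refine eq_of_forall_mk_pow_eq Jp fun n => ?_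
  change Ideal.Quotient.mk (Jp ^ n) (θi (toCInt hϖ x)) = Ideal.Quotient.mk (Jp ^ n)
    (maxUnramifiedCompletion.liftOfIntegers Jp (ofMaxUnramifiedIntegersPadic p)
      (Padic.irreducible_natCast_valuationInteger p) _ x)
  rw [mk_liftOfIntegers, famOfIntegers_apply, ← Ideal.quotientMap_mk (J := I ^ n) (I := Jp ^ n) (f := θi) (H := hle n),
    mk_toCInt, fam_apply]
  generalize AdicCompletion.evalₐ (IsLocalRing.maximalIdeal (maxUnramifiedIntegers ℚ_[p])) n x = q
  induction q using Quotient.inductionOn' with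
  | h b =>
    change Ideal.Quotient.mk (Jp ^ n) (θi (ofMaxUnramifiedIntegers ℚ_[p] b)) =
      Ideal.Quotient.mk (Jp ^ n) (ofMaxUnramifiedIntegersPadic p b)
    rw [hθi_of]

/-- Hence **a series over `𝐃` read in `ℂ_[p]` through `θ ∘ ι` is the series read through `J`**:
`(H.map ι').map θ = H.map J` with `ι' = maxUnramifiedCompletion.toC ℚ_[p]`. [cite: FontaineOuyang2022, §3.1] -/
theorem CompletedAlgClosure.map_equivPadicComplex_map_toC
    (H : haveI := Padic.isNonarchimedeanLocalField_holds p; PowerSeries (maxUnramifiedCompletion ℚ_[p])) :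
    haveI := Padic.isNonarchimedeanLocalField_holds p
    (H.map (maxUnramifiedCompletion.toC ℚ_[p])).map (CompletedAlgClosure.equivPadicComplex p).toRingHom =
      H.map (maxUnramifiedCompletion.toPadicComplex p) := by
  haveI := Padic.isNonarchimedeanLocalField_holds p
  ext m
  simp only [PowerSeries.coeff_map, RingEquiv.toRingHom_eq_coe, RingHom.coe_coe,
    CompletedAlgClosure.equivPadicComplex_toC]

end Coefficients

end Literature.NumberTheory.PAdicHodge

end
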